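import Summits.HubbardSuperconductivity.HubbardSuperconductivity.Theorems.AposterioriCapRgSeededBrokenRegimeBoseFermiPinnedParityCalculus
import Summits.HubbardSuperconductivity.HubbardSuperconductivity.Theorems.AposterioriCapRgSeededBrokenRegimeBoseFermiPinnedDerivationExp
import Summits.HubbardSuperconductivity.HubbardSuperconductivity.Theorems.AposterioriCapRgSeededBrokenRegimeBoseFermiPinnedSeedWardBoltzmann

/-!
# The seed Ward identity of the countertermed Hubbard torus, EFFECTIVE-ACTION form
# (crux `SeededBrokenRegimeBoseFermiPinned` = stmt-HubbardSuperconductivity-14047, route AposterioriCapRg)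

Support file (`--supports stmt-HubbardSuperconductivity-14047`).  The "effective-action form, with its quadratic term"
of the `U(1)` Ward identity announced in `Literature/…/GrassmannWardIdentity.lean` (there proved only for the Boltzmann
factor), first GENERICALLY for Salmhofer's `Δ_C` calculus over `ℂ` and then for the MODEL — the crux's named "first
lemma of the flow" (SalmhoferEtAl2004 §4.2; EberleinMetzner2014 §III) in the tree's vocabulary, at every finite
`(L, M, β)`, frame `K`, scale `Λ`, seed `h`:

* `hubbardInteractionCT_mem_evenOdd_zero` — the interaction slot `V + 𝒩_K` is EVEN (quartic + quadratic monomials).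
* `grassmannLaplacian_grassmannExp_neg_of_mem_evenOdd_zero` — THE LAPLACIAN OF AN EVEN EXPONENTIAL:
  `Δ_C e^{-g} = e^{-g} (-Δ_C g + ½ Σ_{X,Y} C(X,Y) ∂_X g ∂_Y g)` for even nilpotent `g` (the algebraic core of Polchinski's
  equation; from the landed `grassmannDeriv_grassmannExp_neg_of_mem_evenOdd_zero`).
* **`chargeOp_effAction`** — THE WARD IDENTITY OF THE EFFECTIVE ACTION (generic): for a neutral even interaction `V`
  with `Z = ∫dμ_C e^{-V}` a unit, `𝒢 = effAction C V` satisfies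
  `N_q 𝒢 + Δ_{C_q} 𝒢 = ½ Σ_{X,Y} C_q(X,Y) ∂_X𝒢 ∂_Y𝒢`, `C_q(X,Y) = (q X + q Y) C(X,Y)` the charge-weighted covariance
  (from `chargeOp_effBoltzmann`, `B = Z · e^{-𝒢}`, the landed parity calculus and derivation-on-exponential lemmas).
* **`seedWard_hubbardEffectiveActionCT`** — THE MODEL INSTANCE for `𝒢^K_{Λ,h} = hubbardEffectiveActionCT L M β U μ h K Λ`
  (whenever `Z^K_{Λ,h} ≠ 0`), with `C_q` the `O(h βL²/Λ²)` anomalous covariance of `SeedWardBoltzmann`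
  (`norm_chargeWeighted_hubbardCovAboveCT_le`); on kernels (`kernel_seedWard_hubbardEffectiveActionCT`):
  `(#ψ⁺ - #ψ⁻)(X) · 𝒢_m(X) = -(Δ_{C_q}𝒢)_m(X) + ½ (Σ C_q ∂𝒢∂𝒢)_m(X)` — every CHARGED (anomalous) kernel of the seeded
  effective action is LINEAR in the seed blocks `C_q`, through the kernels two degrees up and a bilinear form in the
  derivatives: the exact finite-volume pin "anomalous vertices ∝ h" that the line's STEP stub needs; and at `h = 0`
  (`chargeOp_hubbardEffectiveActionCT_zero_seed`) the effective action is infinitesimally `U(1)`-invariant, `N_q 𝒢 = 0`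
  (the derivation form of S10b).

Exact algebra in the finite Grassmann algebra; no analysis.  Sources as in `GrassmannWardIdentity.lean`
(SalmhoferEtAl2004 §4.2; BenfattoGiulianiMastropietro2006 §2.1; Salmhofer1999 §4.3); the statements are folklore.
-/

set_option linter.dupNamespace false -- `Summit.<S>.<S>` doubles the summit name (tree convention)

namespace Summit.HubbardSuperconductivity.HubbardSuperconductivity.Theorems.AposterioriCapRgSeededBrokenRegimeBoseFermiPinned

open Literature.MathematicalPhysics.QuantumLattice Literature.Probability.LatticeModels GrassmannAlgebra

/-! ### The interaction slot is even -/

/-- A product of two generators is even. [folklore] -/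
theorem gen_mul_gen_mem_evenOdd_zero {Γ : Type} [DecidableEq Γ] (X Y : Γ) :
    gen ℂ X * gen ℂ Y ∈ GrassmannAlgebra.evenOdd ℂ (ι := Γ) 0 := by
  exact mem_evenOdd_of_index_eq (by decide) (SetLike.mul_mem_graded (gen_mem_evenOdd_one ℂ X) (gen_mem_evenOdd_one ℂ Y))

/-- **The interaction slot `V + 𝒩_K` is even**: the Hubbard vertex is a sum of quartic monomials and the counterterm a
sum of quadratic ones. [folklore] -/
theorem hubbardInteractionCT_mem_evenOdd_zero :
    ∀ (L M : ℕ) [NeZero L] (β U : ℝ) (K : TrigPolyC4v),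
      hubbardInteractionCT L M β U K ∈ GrassmannAlgebra.evenOdd ℂ (ι := HubbardFieldIdx L M) 0 := by
  intro L M _ β U K
  have h2 : ∀ (k k' : FreqMomentum L M) (σ σ' : Fin 2),
      psiPlus k σ * psiMinus k' σ' ∈ GrassmannAlgebra.evenOdd ℂ (ι := HubbardFieldIdx L M) 0 :=
    fun k k' σ σ' => gen_mul_gen_mem_evenOdd_zero _ _
  refine Submodule.add_mem _ ?_ ?_
  · rw [hubbardInteraction]
    refine Submodule.smul_mem _ _ (Submodule.sum_mem _ fun k₁ _ => Submodule.sum_mem _ fun k₂ _ =>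
      Submodule.sum_mem _ fun k₃ _ => Submodule.sum_mem _ fun k₄ _ => ?_)
    split_ifs
    · rw [mul_assoc]
      exact mul_mem_evenOdd_zero ℂ (h2 k₁ k₂ 0 0) (h2 k₃ k₄ 1 1)
    · exact Submodule.zero_mem _
  · rw [counterQuadratic]
    exact Submodule.sum_mem _ fun k _ => Submodule.sum_mem _ fun σ _ => Submodule.smul_mem _ _ (h2 k k σ σ)

/-! ### The Laplacian of an even exponential -/

/-- **The fermionic Laplacian of the exponential of an even nilpotent**:
`Δ_C e^{-g} = e^{-g} · (-Δ_C g + ½ Σ_{X,Y} C(X,Y) ∂_X g ∂_Y g)` — the algebraic core of Polchinski's equation and of the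
effective-action Ward identity (two applications of `∂ e^{-g} = -e^{-g} ∂g` and the plain Leibniz rule for the even
factor `e^{-g}`). [cite: Salmhofer1999, §4.3.2 (4.86)–(4.88)] -/
theorem grassmannLaplacian_grassmannExp_neg_of_mem_evenOdd_zero :
    ∀ {Γ : Type} [Fintype Γ] (C : Matrix Γ Γ ℂ) {g : GrassmannAlgebra ℂ Γ}, g ∈ GrassmannAlgebra.evenOdd ℂ 0 →
      IsNilpotent g → grassmannLaplacian ℂ C (grassmannExp (-g)) =
        grassmannExp (-g) * (-grassmannLaplacian ℂ C g +
          (1 / 2 : ℂ) • ∑ X, ∑ Y, C X Y • (grassmannDeriv ℂ X g * grassmannDeriv ℂ Y g)) := by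
  intro Γ _ C g hg hn
  have hE : grassmannExp (-g) ∈ GrassmannAlgebra.evenOdd ℂ 0 :=
    grassmannExp_mem_evenOdd_zero ℂ (Submodule.neg_mem _ hg) hn.neg
  have hEinv : CliffordAlgebra.involute (grassmannExp (-g)) = grassmannExp (-g) :=
    CliffordAlgebra.involute_eq_of_mem_even hE
  rw [grassmannLaplacian_apply, grassmannLaplacian_apply]
  have hXY : ∀ X Y, grassmannDeriv ℂ X (grassmannDeriv ℂ Y (grassmannExp (-g))) =
      grassmannExp (-g) * (grassmannDeriv ℂ X g * grassmannDeriv ℂ Y g) -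
        grassmannExp (-g) * grassmannDeriv ℂ X (grassmannDeriv ℂ Y g) := by
    intro X Y
    rw [grassmannDeriv_grassmannExp_neg_of_mem_evenOdd_zero Y hg hn, map_neg,
      grassmannDeriv_mul_of_involute_eq ℂ X hEinv, grassmannDeriv_grassmannExp_neg_of_mem_evenOdd_zero X hg hn]
    noncomm_ring
  simp only [hXY, smul_sub, Finset.sum_sub_distrib, mul_add, mul_neg, Finset.mul_sum, mul_smul_comm]
  rw [Rat.smul_one_eq_cast]
  push_cast
  abel

/-! ### The Ward identity of the effective action (generic) -/

/-- **THE WARD IDENTITY OF THE EFFECTIVE ACTION**: for a NEUTRAL (`N_q V = 0`) EVEN interaction `V` whose normalised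
partition function `Z = ∫ dμ_C e^{-V}` is a unit, the Wilsonian effective action `𝒢 = effAction C V` satisfies
`N_q 𝒢 + Δ_{C_q} 𝒢 = ½ Σ_{X,Y} C_q(X,Y) · ∂_X𝒢 · ∂_Y𝒢` with the charge-weighted covariance `C_q(X,Y) = (q X + q Y) C(X,Y)`:
the charge of `𝒢` is generated by the charge-violating blocks of the covariance through a Laplacian term and a
quadratic term (the effective-action form of `chargeOp_effBoltzmann`; SHML 2004 §4.2, Eberlein–Metzner 2014 §III at
the level of generating functionals). [cite: SalmhoferEtAl2004, §4.2] -/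
theorem chargeOp_effAction :
    ∀ {Γ : Type} [Fintype Γ] [DecidableEq Γ] (q : Γ → ℂ) (C : Matrix Γ Γ ℂ) {V : GrassmannAlgebra ℂ Γ},
      chargeOp ℂ q V = 0 → V ∈ GrassmannAlgebra.evenOdd ℂ 0 → IsUnit (effPartitionFn ℂ C V) →
        chargeOp ℂ q (effAction ℂ C V) + grassmannLaplacian ℂ (chargeWeighted ℂ q C) (effAction ℂ C V) =
          (1 / 2 : ℂ) • ∑ X, ∑ Y, chargeWeighted ℂ q C X Y •
            (grassmannDeriv ℂ X (effAction ℂ C V) * grassmannDeriv ℂ Y (effAction ℂ C V)) := by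
  intro Γ _ _ q C V hV hVe hZ
  set G := effAction ℂ C V with hG
  have hGe : G ∈ GrassmannAlgebra.evenOdd ℂ 0 := effAction_mem_evenOdd_zero C hVe
  have hGn : IsNilpotent G := isNilpotent_of_constPart_eq_zero ℂ (constPart_effAction ℂ C V hZ)
  -- the Ward identity of the Boltzmann factor `B = Z • exp(-G)`
  have hW := chargeOp_effBoltzmann ℂ q C hV
  rw [effBoltzmann_eq_smul_grassmannExp ℂ C V hZ, ← hG, LinearMap.map_smul_of_tower,
    LinearMap.map_smul_of_tower, ← smul_add, chargeOp_grassmannExp_neg_of_mem_evenOdd_zero q hGe hGn,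
    grassmannLaplacian_grassmannExp_neg_of_mem_evenOdd_zero (chargeWeighted ℂ q C) hGe hGn] at hW
  -- cancel the unit `Z` and the unit `exp(-G)`
  have hZ0 : effPartitionFn ℂ C V ≠ 0 := hZ.ne_zero
  have hW' := (smul_eq_zero.1 hW).resolve_left hZ0
  have hfac : -(grassmannExp (-G) * chargeOp ℂ q G) + grassmannExp (-G) * (-grassmannLaplacian ℂ (chargeWeighted ℂ q C) G +
      (1 / 2 : ℂ) • ∑ X, ∑ Y, chargeWeighted ℂ q C X Y • (grassmannDeriv ℂ X G * grassmannDeriv ℂ Y G)) =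
      grassmannExp (-G) * (-(chargeOp ℂ q G + grassmannLaplacian ℂ (chargeWeighted ℂ q C) G) +
        (1 / 2 : ℂ) • ∑ X, ∑ Y, chargeWeighted ℂ q C X Y • (grassmannDeriv ℂ X G * grassmannDeriv ℂ Y G)) := by
    noncomm_ring
  rw [hfac] at hW'
  have hunit : grassmannExp G * grassmannExp (-G) = 1 := IsNilpotent.exp_mul_exp_neg_self hGn
  have := congrArg (grassmannExp G * ·) hW'
  rw [← mul_assoc, hunit, one_mul, mul_zero] at this
  exact (neg_add_eq_zero.1 this).symm ▸ rfl

/-! ### The model instance -/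

/-- **THE SEED WARD IDENTITY of the countertermed Hubbard torus, effective-action form**: whenever the normalised
partition function `Z^K_{Λ,h}` does not vanish, the effective action `𝒢 = 𝒢^K_{Λ,h}` of the seeded torus satisfies
`N_q 𝒢 + Δ_{C_q} 𝒢 = ½ Σ_{X,Y} C_q(X,Y) ∂_X𝒢 ∂_Y𝒢`, `q(ψ⁺) = 1`, `q(ψ⁻) = -1`, `C_q` the (`O(h βL²/Λ²)`, anomalous)
charge-weighted CT covariance above scale `Λ` — every finite `L ≥ 1`, `M`, `β`, `U`, `μ`, `h`, frame `K`, scale `Λ`.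
[cite: SalmhoferEtAl2004, §4.2] -/
theorem seedWard_hubbardEffectiveActionCT :
    ∀ (L M : ℕ) [NeZero L] (β U μ h : ℝ) (K : TrigPolyC4v) (Λ : ℝ), hubbardEffPartitionFnCT L M β U μ h K Λ ≠ 0 →
      chargeOp ℂ (fun X : HubbardFieldIdx L M => if X.2 = 0 then (1:ℂ) else -1) (hubbardEffectiveActionCT L M β U μ h K Λ) +
        grassmannLaplacian ℂ (chargeWeighted ℂ (fun X : HubbardFieldIdx L M => if X.2 = 0 then (1:ℂ) else -1)
          (hubbardCovAboveCT L M β μ h K Λ)) (hubbardEffectiveActionCT L M β U μ h K Λ) =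
        (1 / 2 : ℂ) • ∑ X, ∑ Y, chargeWeighted ℂ (fun X : HubbardFieldIdx L M => if X.2 = 0 then (1:ℂ) else -1)
          (hubbardCovAboveCT L M β μ h K Λ) X Y •
            (grassmannDeriv ℂ X (hubbardEffectiveActionCT L M β U μ h K Λ) *
              grassmannDeriv ℂ Y (hubbardEffectiveActionCT L M β U μ h K Λ)) := by
  intro L M _ β U μ h K Λ hZ
  rw [hubbardEffectiveActionCT_def]
  exact chargeOp_effAction _ _ (chargeOp_hubbardInteractionCT L M β U K) (hubbardInteractionCT_mem_evenOdd_zero L M β U K)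
    (isUnit_iff_ne_zero.2 hZ)

/-- **The seed Ward identity on the kernels of the effective action**: a kernel of `𝒢^K_{Λ,h}` with total charge
`Σᵢ q(Xᵢ) = #ψ⁺ - #ψ⁻ ≠ 0` is determined by the seed blocks `C_q` through the kernels two degrees up (Laplacian term)
and the bilinear derivative term: `(Σᵢ q(Xᵢ)) · 𝒢_m(X) = -(Δ_{C_q} 𝒢)_m(X) + ½ (Σ C_q ∂𝒢 ∂𝒢)_m(X)`. [folklore] -/
theorem kernel_seedWard_hubbardEffectiveActionCT :
    ∀ (L M : ℕ) [NeZero L] (β U μ h : ℝ) (K : TrigPolyC4v) (Λ : ℝ) (m : ℕ) (X : Fin m → HubbardFieldIdx L M),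
      hubbardEffPartitionFnCT L M β U μ h K Λ ≠ 0 →
        (∑ i, (if (X i).2 = 0 then (1:ℂ) else -1)) * kernel ℂ (hubbardEffectiveActionCT L M β U μ h K Λ) m X =
          -kernel ℂ (grassmannLaplacian ℂ (chargeWeighted ℂ (fun X : HubbardFieldIdx L M => if X.2 = 0 then (1:ℂ) else -1)
              (hubbardCovAboveCT L M β μ h K Λ)) (hubbardEffectiveActionCT L M β U μ h K Λ)) m X +
            kernel ℂ ((1 / 2 : ℂ) • ∑ X, ∑ Y, chargeWeighted ℂ (fun X : HubbardFieldIdx L M => if X.2 = 0 then (1:ℂ) else -1)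
              (hubbardCovAboveCT L M β μ h K Λ) X Y •
                (grassmannDeriv ℂ X (hubbardEffectiveActionCT L M β U μ h K Λ) *
                  grassmannDeriv ℂ Y (hubbardEffectiveActionCT L M β U μ h K Λ))) m X := by
  intro L M _ β U μ h K Λ m X hZ
  have h := congrArg (fun F => kernel ℂ F m X) (seedWard_hubbardEffectiveActionCT L M β U μ h K Λ hZ)
  simp only [kernel_add, kernel_chargeOp] at h
  linear_combination h

/-- **At zero seed the effective action is infinitesimally `U(1)`-invariant**: `N_q 𝒢^K_{Λ,0} = 0` whenever
`Z^K_{Λ,0} ≠ 0` (the charge-weighted covariance vanishes at `h = 0`, so both seed terms drop out) — the derivation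
form of S10b `stub_chargeNeutrality`. [folklore] -/
theorem chargeOp_hubbardEffectiveActionCT_zero_seed :
    ∀ (L M : ℕ) [NeZero L] (β U μ : ℝ) (K : TrigPolyC4v) (Λ : ℝ), hubbardEffPartitionFnCT L M β U μ 0 K Λ ≠ 0 →
      chargeOp ℂ (fun X : HubbardFieldIdx L M => if X.2 = 0 then (1:ℂ) else -1) (hubbardEffectiveActionCT L M β U μ 0 K Λ) = 0 := by
  intro L M _ β U μ K Λ hZ
  have h := seedWard_hubbardEffectiveActionCT L M β U μ 0 K Λ hZ
  rw [chargeWeighted_hubbardCovAboveCT_zero_seed L M β μ K Λ, grassmannLaplacian_zero, LinearMap.zero_apply,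
    add_zero] at h
  rw [h]
  simp

end Summit.HubbardSuperconductivity.HubbardSuperconductivity.Theorems.AposterioriCapRgSeededBrokenRegimeBoseFermiPinned
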